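/-
Copyright: the b2b-balaban T⁴-continuum CRUX team, row NE7b OWNER lineage `t4-ne7b-p1` (gen 122). Project licence.
-/
import Summits.QuantumFields.BalabanUV.T4Continuum.Spine.NE7b.SupTorusVolumeComparisonInverse

/-!
# THE ROAD'S RESPONSE `h_{y₀} = Σ_{y′}T⁻¹(y′,y₀)ψ_{y′}` (`= Dt e_{y₀}`) IS VOLUME-INDEPENDENT UP TO `e^{−δs}`, `d ≥ 3`: between two tori of coarse
# periods `s ∣ st`, the small response lifted along `πf` IS the deck superposition of the large responses — `h^s_{πc ŷ₀}∘πf =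
# Σ_{πc ŷ″ = πc ŷ₀} h^{st}_{ŷ″}` EXACTLY ((159) `column_lift_eq` ⊛ (160) `inverse_fold`) — and the far translates decay pointwise ((155)
# `response_pointwise_decay_road`): `|h^{st}_{ŷ₀}(x) − h^s_{πc ŷ₀}(πf x)| ≤ C·e^{2δρ_{st}(bt x, ŷ₀)}·e^{−δs}` at EVERY large site on the road's
# two-sided class (row NE7b, node U5c; the response half of § [NE7bP1-G121-HANDOFF] NEXT (3)(e); (155)∕(158)∕(159)∕(160) BY NAME; [folklore])

Cell `pub-balaban`, sub-cell `t4`, spine estimate NE7b (`T4WeightBudget.RelWeightBound`; the cell's OWN estimate — NOT PRINTED in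
[Bałaban 1983–89], NOT PROVED).  Crux-route work under `Spine/NE7b/` by the row OWNER (`t4-ne7b-p1` gen 122, file (161)) under FREEZE
(0)'s crux-prover clause; NOTHING of Bałaban's is named as a Lean object, valued or asserted; no `T4Continuum/Support` leaf typed; no `def`,
no notation (actions, `T`, covering maps DISPLAYED); zero `sorry`.  Imports (BY NAME): the OWNER's (160) `…SupTorusVolumeComparisonInverse`
(`inverse_fold`; through it (159) `column_lift_eq`, (158) `deck_sum_exp_le`, (155) `response_pointwise_decay_road`, (132) `isPseudoDist_torus`).

WHY (located).  (158) compared the propagator, (159)∕(160) the next-scale Hessian; the third object of the road's step is the response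
operator `Dt` ((100)), whose columns are `h_{y₀} = Σ_{y′}T⁻¹(y′,y₀)ψ_{y′}` ((136)∕(150)).  Lifting the small response: `ψ^s_{y′}∘πf =
Σ_{πc ŷ′ = y′} ψ^{st}_{ŷ′}` ((159)), so `h^s_{πc ŷ₀}∘πf = Σ_{ŷ′} T_s⁻¹(πc ŷ′, πc ŷ₀)ψ^{st}_{ŷ′}`, and `T_s⁻¹(πc ŷ′, πc ŷ₀) = Σ_{πc ŷ″ = πc ŷ₀}
T_{st}⁻¹(ŷ′, ŷ″)` ((160) `inverse_fold`): exchanging the sums gives the deck superposition of the large responses; (155) bounds each far one by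
`C₂e^{−δ₂ρ(bt x, ŷ″)}` and (158) `deck_sum_exp_le` sums them.

WHAT IS PROVED ([folklore]; tori, columns, covering maps as in (159)∕(160)):
* §1 **`response_lift_eq`** (two-sided class): `Σ_{y′}T_s⁻¹(y′, πc ŷ₀)·ψ^s_{y′}(πf x) = Σ_{ŷ″} 𝟙[πc ŷ″ = πc ŷ₀]·Σ_{ŷ′}T_{st}⁻¹(ŷ′,ŷ″)·ψ^{st}_{ŷ′}(x)`.
* §2 THE HEADLINE **`response_volume_comparison`**: `d ≥ 3`, `a > 0`, `λ < min(2,a)`, `Λ ≥ 0` ⟹ `∃ C δ > 0`: for ALL `n, s, t`, covering maps,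
  `−λ ≤ V ≤ Λ`, block columns on both tori, every `ŷ₀` and every large site `x`:
  `|Σ_{ŷ′}T_{st}⁻¹(ŷ′,ŷ₀)ψ^{st}_{ŷ′}(x) − Σ_{y′}T_s⁻¹(y′, πc ŷ₀)ψ^s_{y′}(πf x)| ≤ C·e^{2δρ_{st}(bt x, ŷ₀)}·e^{−δs}`.
* §3 toy (`d = 3`).

HONEST (what this is NOT).  Two commensurable tori, not `ℤ^d`; periodic potentials; `d ≥ 3` for the decay input; constants existential;
cubic periods; scalar skeleton ((A3), NC-NE7b-α UNRULED); nothing of Bałaban's.  BY-NAME EFFECT ON THE WALL: NONE.  NE7b NOT PRINTED ∕ NOT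
PROVED; spine PROVED 0∕9; rung (B)+1 on a FINITE torus — NOT infinite volume, NOT the mass gap, NOT Clay.  HONEST DEPENDENCY: continuum YM on
T⁴ ⇐ BetaPertH ∧ nine spine estimates (0∕9 proved); BetaPertH ⇐ (D1) ∧ (D4) ∧ CAP+tail; G-an2-4 gates asym, D1 and NE2∕3∕4.
-/

set_option autoImplicit false

noncomputable section

namespace Summit.QuantumFields.BalabanUV.T4Continuum.NE7b.SupTorusVolumeComparisonResponse

open Real
open Literature.MathematicalPhysics.QuantumFieldTheory.Balaban1983to89
open B6QGQLower276 (X e blk B side chart mem_B sum_B sum_B_const card_cube blk_chart)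
open Beta (Site siteOf windowMap siteOf_windowMap siteOf_add siteOf_sub)
open SupTorusBlockDistance (isPseudoDist_torus)
open SupTorusPointwiseRoadColumn (response_pointwise_decay_road)
open SupTorusVolumeComparison (deck_sum_exp_le)
open SupTorusVolumeComparisonNextScale (column_lift_eq)
open SupTorusVolumeComparisonInverse (inverse_fold)

variable {d : ℕ}

/-! ## §1. The lifted small response is the deck superposition of the large responses -/

section Lift

variable (n : ℕ) (a : ℝ) (s t : ℕ) [NeZero s] [NeZero t]
  (πf : Site d ((n + 1) * (s * t)) → Site d ((n + 1) * s)) (πc : Site d (s * t) → Site d s)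
  (hπf : ∀ q : X d, πf (siteOf d ((n + 1) * (s * t)) q) = siteOf d ((n + 1) * s) q)
  (hπc : ∀ b : X d, πc (siteOf d (s * t) b) = siteOf d s b)
  (ha : 0 < a) {lam Lam : ℝ} (hlam : lam < min 2 a) (hLam : 0 ≤ Lam) (V : Site d ((n + 1) * s) → ℝ) (hV : ∀ x, -lam ≤ V x)
  (hV' : ∀ x, V x ≤ Lam)
  (ψs : Site d s → Site d ((n + 1) * s) → ℝ)
  (hψs : ∀ y' x, ((n : ℝ) + 1) ^ 2 * ∑ μ, (2 * ψs y' x - ψs y' (x + siteOf d ((n + 1) * s) (e μ)) - ψs y' (x - siteOf d ((n + 1) * s) (e μ)))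
      + a / ((n : ℝ) + 1) ^ d * ∑ q ∈ B n (blk n (windowMap d ((n + 1) * s) x)), ψs y' (siteOf d ((n + 1) * s) q) + V x * ψs y' x
      = if siteOf d s (blk n (windowMap d ((n + 1) * s) x)) = y' then 1 else 0)
  (ψS : Site d (s * t) → Site d ((n + 1) * (s * t)) → ℝ)
  (hψS : ∀ ŷ' x, ((n : ℝ) + 1) ^ 2 * ∑ μ, (2 * ψS ŷ' x - ψS ŷ' (x + siteOf d ((n + 1) * (s * t)) (e μ))
        - ψS ŷ' (x - siteOf d ((n + 1) * (s * t)) (e μ)))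
      + a / ((n : ℝ) + 1) ^ d * ∑ q ∈ B n (blk n (windowMap d ((n + 1) * (s * t)) x)), ψS ŷ' (siteOf d ((n + 1) * (s * t)) q)
      + V (πf x) * ψS ŷ' x
      = if siteOf d (s * t) (blk n (windowMap d ((n + 1) * (s * t)) x)) = ŷ' then 1 else 0)

include hπf hπc ha hlam hLam hV hV' hψs hψS in
/-- **THE LIFTED SMALL RESPONSE IS THE DECK SUPERPOSITION OF THE LARGE RESPONSES**:
`Σ_{y′}T_s⁻¹(y′, πc ŷ₀)·ψ^s_{y′}(πf x) = Σ_{ŷ″} 𝟙[πc ŷ″ = πc ŷ₀]·(Σ_{ŷ′}T_{st}⁻¹(ŷ′, ŷ″)·ψ^{st}_{ŷ′}(x))` ((159) `column_lift_eq`, (160)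
`inverse_fold`, exchange of finite sums). [folklore] -/
theorem response_lift_eq (ŷ₀ : Site d (s * t)) (x : Site d ((n + 1) * (s * t))) :
    ∑ y' : Site d s, (Matrix.of fun yy y'' : Site d s =>
        (((n : ℝ) + 1) ^ d)⁻¹ * ∑ z : Fin d → Fin (n + 1), ψs y'' (siteOf d ((n + 1) * s) (chart n (windowMap d s yy) z)))⁻¹ y' (πc ŷ₀)
        * ψs y' (πf x)
      = ∑ ŷ'' : Site d (s * t), (if πc ŷ'' = πc ŷ₀ then (1 : ℝ) else 0)
        * ∑ ŷ' : Site d (s * t), (Matrix.of fun yy y'' : Site d (s * t) =>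
          (((n : ℝ) + 1) ^ d)⁻¹ * ∑ z : Fin d → Fin (n + 1), ψS y'' (siteOf d ((n + 1) * (s * t)) (chart n (windowMap d (s * t) yy) z)))⁻¹ ŷ' ŷ''
          * ψS ŷ' x := by
  classical
  have hm0 : 0 < min 2 a - lam := by linarith
  set Ts : Matrix (Site d s) (Site d s) ℝ := Matrix.of fun yy y'' : Site d s =>
    (((n : ℝ) + 1) ^ d)⁻¹ * ∑ z : Fin d → Fin (n + 1), ψs y'' (siteOf d ((n + 1) * s) (chart n (windowMap d s yy) z)) with hTs_def
  set TS : Matrix (Site d (s * t)) (Site d (s * t)) ℝ := Matrix.of fun yy y'' : Site d (s * t) =>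
    (((n : ℝ) + 1) ^ d)⁻¹ * ∑ z : Fin d → Fin (n + 1), ψS y'' (siteOf d ((n + 1) * (s * t)) (chart n (windowMap d (s * t) yy) z)) with hTS_def
  -- lift the small columns
  have hcol : ∀ y' : Site d s, ψs y' (πf x) = ∑ ŷ' : Site d (s * t), (if πc ŷ' = y' then (1 : ℝ) else 0) * ψS ŷ' x := fun y' =>
    congrFun (column_lift_eq n a s t πf πc hπf hπc ha.le hm0 V hV ψs hψs ψS hψS y') x
  -- fold the small inverse
  have hinv : ∀ ŷ' : Site d (s * t), Ts⁻¹ (πc ŷ') (πc ŷ₀)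
      = ∑ ŷ'' : Site d (s * t), (if πc ŷ'' = πc ŷ₀ then (1 : ℝ) else 0) * TS⁻¹ ŷ' ŷ'' := fun ŷ' =>
    inverse_fold n a s t πf πc hπf hπc ha hlam hLam V hV hV' ψs hψs ψS hψS ŷ' (πc ŷ₀)
  calc ∑ y' : Site d s, Ts⁻¹ y' (πc ŷ₀) * ψs y' (πf x)
      = ∑ y' : Site d s, ∑ ŷ' : Site d (s * t), (if πc ŷ' = y' then (1 : ℝ) else 0) * (Ts⁻¹ y' (πc ŷ₀) * ψS ŷ' x) := by
        refine Finset.sum_congr rfl fun y' _ => ?_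
        rw [hcol y', Finset.mul_sum]
        exact Finset.sum_congr rfl fun ŷ' _ => by ring
    _ = ∑ ŷ' : Site d (s * t), Ts⁻¹ (πc ŷ') (πc ŷ₀) * ψS ŷ' x := by
        rw [Finset.sum_comm]
        refine Finset.sum_congr rfl fun ŷ' _ => ?_
        simp only [ite_mul, one_mul, zero_mul, Finset.sum_ite_eq, Finset.mem_univ, if_true]
    _ = ∑ ŷ' : Site d (s * t), ∑ ŷ'' : Site d (s * t), (if πc ŷ'' = πc ŷ₀ then (1 : ℝ) else 0) * (TS⁻¹ ŷ' ŷ'' * ψS ŷ' x) := by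
        refine Finset.sum_congr rfl fun ŷ' _ => ?_
        rw [hinv ŷ', Finset.sum_mul]
        exact Finset.sum_congr rfl fun ŷ'' _ => by ring
    _ = ∑ ŷ'' : Site d (s * t), (if πc ŷ'' = πc ŷ₀ then (1 : ℝ) else 0) * ∑ ŷ' : Site d (s * t), TS⁻¹ ŷ' ŷ'' * ψS ŷ' x := by
        rw [Finset.sum_comm]
        exact Finset.sum_congr rfl fun ŷ'' _ => (Finset.mul_sum _ _ _).symm

end Lift

/-! ## §2. THE END: the responses of two commensurable volumes agree up to `e^{−δs}` -/

/-- **HEADLINE — VOLUME INDEPENDENCE OF THE RESPONSE UP TO `e^{−δs}`, `d ≥ 3`, two-sided class.**  `∃ C δ > 0` (from `(d, a, λ, Λ)` and `C(d)`) such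
that for ALL `n, s, t`, covering maps, small potentials `−λ ≤ V ≤ Λ`, block columns on both tori, every large block `ŷ₀` and every large site `x`:
`|h^{st}_{ŷ₀}(x) − h^s_{πc ŷ₀}(πf x)| ≤ C·e^{2δρ_{st}(bt x, ŷ₀)}·e^{−δs}` — §1, then the far deck translates by (155) `response_pointwise_decay_road`
and (158) `deck_sum_exp_le`.  With (158)∕(160): all three linear objects of the road's step are volume-independent up to `e^{−δs}`. [folklore] -/
theorem response_volume_comparison (hd : 3 ≤ d) (a : ℝ) (ha : 0 < a) {lam Lam : ℝ} (hlam : lam < min 2 a) (hLam : 0 ≤ Lam) :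
    ∃ C δ : ℝ, 0 < C ∧ 0 < δ ∧ ∀ (n s t : ℕ) [NeZero s] [NeZero t]
      (πf : Site d ((n + 1) * (s * t)) → Site d ((n + 1) * s)) (πc : Site d (s * t) → Site d s),
      (∀ q : X d, πf (siteOf d ((n + 1) * (s * t)) q) = siteOf d ((n + 1) * s) q) →
      (∀ b : X d, πc (siteOf d (s * t) b) = siteOf d s b) →
      ∀ (V : Site d ((n + 1) * s) → ℝ), (∀ x, -lam ≤ V x) → (∀ x, V x ≤ Lam) →
      ∀ ψs : Site d s → Site d ((n + 1) * s) → ℝ,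
      (∀ y' x, ((n : ℝ) + 1) ^ 2 * ∑ μ, (2 * ψs y' x - ψs y' (x + siteOf d ((n + 1) * s) (e μ)) - ψs y' (x - siteOf d ((n + 1) * s) (e μ)))
        + a / ((n : ℝ) + 1) ^ d * ∑ q ∈ B n (blk n (windowMap d ((n + 1) * s) x)), ψs y' (siteOf d ((n + 1) * s) q) + V x * ψs y' x
        = if siteOf d s (blk n (windowMap d ((n + 1) * s) x)) = y' then 1 else 0) →
      ∀ ψS : Site d (s * t) → Site d ((n + 1) * (s * t)) → ℝ,
      (∀ ŷ' x, ((n : ℝ) + 1) ^ 2 * ∑ μ, (2 * ψS ŷ' x - ψS ŷ' (x + siteOf d ((n + 1) * (s * t)) (e μ))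
          - ψS ŷ' (x - siteOf d ((n + 1) * (s * t)) (e μ)))
        + a / ((n : ℝ) + 1) ^ d * ∑ q ∈ B n (blk n (windowMap d ((n + 1) * (s * t)) x)), ψS ŷ' (siteOf d ((n + 1) * (s * t)) q)
        + V (πf x) * ψS ŷ' x
        = if siteOf d (s * t) (blk n (windowMap d ((n + 1) * (s * t)) x)) = ŷ' then 1 else 0) →
      ∀ (ŷ₀ : Site d (s * t)) (x : Site d ((n + 1) * (s * t))),
        |∑ ŷ' : Site d (s * t), (Matrix.of fun yy y'' : Site d (s * t) =>
            (((n : ℝ) + 1) ^ d)⁻¹ * ∑ z : Fin d → Fin (n + 1), ψS y'' (siteOf d ((n + 1) * (s * t)) (chart n (windowMap d (s * t) yy) z)))⁻¹ ŷ' ŷ₀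
            * ψS ŷ' x
          - ∑ y' : Site d s, (Matrix.of fun yy y'' : Site d s =>
            (((n : ℝ) + 1) ^ d)⁻¹ * ∑ z : Fin d → Fin (n + 1), ψs y'' (siteOf d ((n + 1) * s) (chart n (windowMap d s yy) z)))⁻¹ y' (πc ŷ₀)
            * ψs y' (πf x)|
          ≤ C * exp (2 * δ * ∑ i, ((((siteOf d (s * t) (blk n (windowMap d ((n + 1) * (s * t)) x))) i - ŷ₀ i).valMinAbs.natAbs : ℕ) : ℝ))
            * exp (-(δ * s)) := by
  classical
  obtain ⟨C₂, δ₂, hC₂, hδ₂, H155⟩ := response_pointwise_decay_road (d := d) hd a ha hlam hLam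
  set δ : ℝ := δ₂ / 2 with hδ_def
  have hδ0 : 0 < δ := by positivity
  set K : ℝ := (2 * (1 - exp (-δ))⁻¹) ^ d with hK
  have hK0 : 0 ≤ K := pow_nonneg (mul_nonneg zero_le_two (inv_nonneg.2 (sub_nonneg.2 (exp_le_one_iff.2 (by linarith))))) d
  refine ⟨C₂ * K + 1, δ, by positivity, hδ0, ?_⟩
  intro n s t _ _ πf πc hπf hπc V hV hV' ψs hψs ψS hψS ŷ₀ x
  have hW : ∀ x', -lam ≤ V (πf x') := fun x' => hV _
  have hW' : ∀ x', V (πf x') ≤ Lam := fun x' => hV' _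
  set TS : Matrix (Site d (s * t)) (Site d (s * t)) ℝ := Matrix.of fun yy y'' : Site d (s * t) =>
    (((n : ℝ) + 1) ^ d)⁻¹ * ∑ z : Fin d → Fin (n + 1), ψS y'' (siteOf d ((n + 1) * (s * t)) (chart n (windowMap d (s * t) yy) z)) with hTS_def
  -- each large response decays from its block
  have hdec : ∀ ŷ'' : Site d (s * t), |∑ ŷ' : Site d (s * t), TS⁻¹ ŷ' ŷ'' * ψS ŷ' x| ≤ C₂
      * exp (-(δ₂ * ∑ i, ((((siteOf d (s * t) (blk n (windowMap d ((n + 1) * (s * t)) x))) i - ŷ'' i).valMinAbs.natAbs : ℕ) : ℝ))) := by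
    intro ŷ''
    have h := H155 n (s * t) (fun x' => V (πf x')) hW hW' ψS hψS ŷ'' x
    rw [exp_neg, ← div_eq_mul_inv, le_div_iff₀ (exp_pos _), mul_comm]
    exact h
  have hlift := response_lift_eq n a s t πf πc hπf hπc ha hlam hLam V hV hV' ψs hψs ψS hψS ŷ₀ x
  have hsplit : ∑ ŷ'' : Site d (s * t), (if πc ŷ'' = πc ŷ₀ then (1 : ℝ) else 0) * ∑ ŷ' : Site d (s * t), TS⁻¹ ŷ' ŷ'' * ψS ŷ' x
      = ∑ ŷ' : Site d (s * t), TS⁻¹ ŷ' ŷ₀ * ψS ŷ' x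
        + ∑ ŷ'' : Site d (s * t), (if ŷ'' ≠ ŷ₀ ∧ πc ŷ'' = πc ŷ₀ then (1 : ℝ) else 0) * ∑ ŷ' : Site d (s * t), TS⁻¹ ŷ' ŷ'' * ψS ŷ' x := by
    rw [← Finset.add_sum_erase Finset.univ _ (Finset.mem_univ ŷ₀), if_pos rfl, one_mul,
      ← Finset.add_sum_erase Finset.univ (fun ŷ'' => (if ŷ'' ≠ ŷ₀ ∧ πc ŷ'' = πc ŷ₀ then (1 : ℝ) else 0)
        * ∑ ŷ' : Site d (s * t), TS⁻¹ ŷ' ŷ'' * ψS ŷ' x) (Finset.mem_univ ŷ₀)]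
    simp only [ne_eq, not_true_eq_false, false_and, if_false, zero_mul, zero_add]
    congr 1
    exact Finset.sum_congr rfl fun ŷ'' hŷ => by rw [Finset.mem_erase] at hŷ; simp only [hŷ.1, not_false_eq_true, true_and]
  have hdiff : ∑ ŷ' : Site d (s * t), TS⁻¹ ŷ' ŷ₀ * ψS ŷ' x
        - ∑ y' : Site d s, (Matrix.of fun yy y'' : Site d s =>
            (((n : ℝ) + 1) ^ d)⁻¹ * ∑ z : Fin d → Fin (n + 1), ψs y'' (siteOf d ((n + 1) * s) (chart n (windowMap d s yy) z)))⁻¹ y' (πc ŷ₀)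
            * ψs y' (πf x)
      = -∑ ŷ'' : Site d (s * t), (if ŷ'' ≠ ŷ₀ ∧ πc ŷ'' = πc ŷ₀ then (1 : ℝ) else 0) * ∑ ŷ' : Site d (s * t), TS⁻¹ ŷ' ŷ'' * ψS ŷ' x := by
    rw [hlift, hsplit]; ring
  rw [hdiff, abs_neg]
  calc |∑ ŷ'' : Site d (s * t), (if ŷ'' ≠ ŷ₀ ∧ πc ŷ'' = πc ŷ₀ then (1 : ℝ) else 0) * ∑ ŷ' : Site d (s * t), TS⁻¹ ŷ' ŷ'' * ψS ŷ' x|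
      ≤ ∑ ŷ'' : Site d (s * t), |(if ŷ'' ≠ ŷ₀ ∧ πc ŷ'' = πc ŷ₀ then (1 : ℝ) else 0) * ∑ ŷ' : Site d (s * t), TS⁻¹ ŷ' ŷ'' * ψS ŷ' x| :=
        Finset.abs_sum_le_sum_abs _ _
    _ ≤ ∑ ŷ'' : Site d (s * t), C₂ * (if ŷ'' ≠ ŷ₀ ∧ πc ŷ'' = πc ŷ₀ then
          exp (-(2 * δ * ∑ i, ((((siteOf d (s * t) (blk n (windowMap d ((n + 1) * (s * t)) x))) i - ŷ'' i).valMinAbs.natAbs : ℕ) : ℝ)))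
          else 0) := by
        refine Finset.sum_le_sum fun ŷ'' _ => ?_
        split_ifs with h
        · rw [one_mul, show 2 * δ = δ₂ by rw [hδ_def]; ring]; exact hdec ŷ''
        · rw [zero_mul, abs_zero, mul_zero]
    _ = C₂ * ∑ ŷ'' : Site d (s * t), (if ŷ'' ≠ ŷ₀ ∧ πc ŷ'' = πc ŷ₀ then
          exp (-(2 * δ * ∑ i, ((((siteOf d (s * t) (blk n (windowMap d ((n + 1) * (s * t)) x))) i - ŷ'' i).valMinAbs.natAbs : ℕ) : ℝ)))
          else 0) := (Finset.mul_sum _ _ _).symm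
    _ ≤ C₂ * (exp (2 * δ * ∑ i, ((((siteOf d (s * t) (blk n (windowMap d ((n + 1) * (s * t)) x))) i - ŷ₀ i).valMinAbs.natAbs : ℕ) : ℝ))
          * exp (-(δ * s)) * K) :=
        mul_le_mul_of_nonneg_left (deck_sum_exp_le s t πc hπc hδ0 ŷ₀ _) hC₂.le
    _ = (C₂ * K) * exp (2 * δ * ∑ i, ((((siteOf d (s * t) (blk n (windowMap d ((n + 1) * (s * t)) x))) i
          - ŷ₀ i).valMinAbs.natAbs : ℕ) : ℝ)) * exp (-(δ * s)) := by ring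
    _ ≤ (C₂ * K + 1) * exp (2 * δ * ∑ i, ((((siteOf d (s * t) (blk n (windowMap d ((n + 1) * (s * t)) x))) i
          - ŷ₀ i).valMinAbs.natAbs : ℕ) : ℝ)) * exp (-(δ * s)) := by
        have : (0 : ℝ) ≤ exp (2 * δ * ∑ i, ((((siteOf d (s * t) (blk n (windowMap d ((n + 1) * (s * t)) x))) i
            - ŷ₀ i).valMinAbs.natAbs : ℕ) : ℝ)) * exp (-(δ * s)) := by positivity
        nlinarith

/-! ## §3. Toy -/

/-- Toy (`d = 3`, `a = 1`, `λ = 0`, `Λ = 1`): the constants exist. -/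
example : ∃ C δ : ℝ, 0 < C ∧ 0 < δ :=
  let ⟨C, δ, hC, hδ, _⟩ := response_volume_comparison (d := 3) le_rfl 1 one_pos (lam := 0) (Lam := 1) (by norm_num) zero_le_one
  ⟨C, δ, hC, hδ⟩

end Summit.QuantumFields.BalabanUV.T4Continuum.NE7b.SupTorusVolumeComparisonResponse
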